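/-
Copyright (c) 2026. All rights reserved.
Released under Apache 2.0 license as described in the file LICENSE.
-/
import Literature.AlgebraicGeometry.Pohlmann1968.AbelianCMFieldSurvivorTernaryCriterion
import Literature.AlgebraicGeometry.Pohlmann1968.MultiquadraticCMFieldRankFiveCensus
import Literature.NumberTheory.ComplexMultiplication.DegenerateCMTypesElementaryAbelianNearBentTypesStabilizer
import HarnessLib

/-!
# Multiquadratic CM fields of square degree: the near-bent CM types — rank `[K:ℚ]/4 + 1`, stabiliser of order `≤ 2`,
# the Hodge conjecture for all powers in the imprimitive case, an exceptional Hodge class in the primitive case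

SETTING.  `K` a MULTIQUADRATIC CM field — Galois over `ℚ` with `G = Gal(K/ℚ)` of exponent `2`
(`K = ℚ(√−d, √a₁, …, √aₙ)`; abelian, tree `Multiquadratic.isAbelianGalois_of_forall_sq_eq_one`) — `ρ = conjGal`
complex conjugation, `φ₀ : K → ℂ` a base embedding, `Φ` a CM type of `K` read on `G` as the group-level CM type
`T = {g ∈ G : σ_g = φ₀ ∘ g⁻¹ ∈ Φ}` (Shimura's indexing, tree `embOf`; `|T| = [K:ℚ]/2`, tree
`CyclicTwoOddPrimes.isCMTypeWith_galType`), `Rank(Φ) = cmTypeRank Φ = rank(T)` the Kubota rank (`= dim MT(A)`; tree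
`cmTypeRank_eq_typeRank_galType`; T. Kubota [Kubota1965] §4 Lemma 2: `rank = 1 + #{χ odd : Σ_{t∈T} χ(t) ≠ 0}`),
`Stab(Φ) = twistStabilizer Φ = {g : Φg = Φ} = Gal(K/K*)` (`K*` the reflex field; G. Shimura [Shimura1998] §8.4
Example (1); `|Stab(Φ)| = |Stab(T)|`, tree `natCard_twistStabilizer_eq_card_stabilizer`).  The tree's Hodge
dictionary for ABELIAN CM fields (B. B. Gordon [Gordon1999HodgeAVSurvey] Thm. 6.4, §9.2–9.3; H. Pohlmann
[Pohlmann1968] Thm. 1; F. Hazama; S. P. White [White1993SporadicCycles] §4 Thm. 3): for every abelian variety `A` of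
type `(K; Φ)` (`IsCMTypeRealisation Φ A ι θ`) the REFLEX BOUND `2·|Stab(Φ)|·(Rank(Φ) − 1) ≤ [K:ℚ]` ([Shimura1998]
§32.10) is an equality iff `Bᵐ(A) ⊗ ℂ = Dᵐ(A) ⊗ ℂ` for all `m` (then the Hodge conjecture holds for every power
`Aⁿ`, tree `hodgeConjectureFor_pow_of_two_mul_natCard_twistStabilizer_mul_eq`), and strict iff `A` carries an
exceptional Hodge class (tree `exists_exceptional_of_two_mul_natCard_twistStabilizer_mul_lt`).
Call `Φ` NEAR-BENT (w.r.t. `φ₀`) when every odd character `χ` of `G` (`χ(ρ) = −1`) has `Σ_{t∈T} χ(t) = 0` or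
`(Σ_{t∈T} χ(t))² = 2|T| = [K:ℚ]` — the CM types whose Boolean function on `G = ⟨ρ⟩ × 𝔽₂ⁿ` is near-bent = semi-bent
(C. Carlet [Carlet2020] §6.2.4; §3.1 p. 81: in odd dimension `n` the bent concatenation bound
`2ⁿ⁻¹ − 2^{(n−1)/2}` «can always be achieved … by the concatenation `x_n f ⊕ (x_n ⊕ 1) g` of two bent functions»;
the predicate is spelled out, nothing is defined).  The group-level theory is the tree's `NearBentTypes` /
`NearBentTypesStabilizer` (seat p10 g43-#3/#4); THIS FILE is its number-field and Hodge dress: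

> **Theorem** (`four_mul_cmTypeRank_sub_one_eq`, `isSquare_finrank`, `exists_nearBent_iff_isSquare_finrank`).  A
> near-bent CM type has **`Rank(Φ) = [K:ℚ]/4 + 1`** (degenerate, half-way down the rank scale); it forces `[K:ℚ]`
> to be a perfect square, and conversely **a multiquadratic CM field has near-bent CM types iff its degree is a
> perfect square** `4ᵏ⁺¹`.
> **Theorem** (`natCard_twistStabilizer_le_two`).  **`|Stab(Φ)| ≤ 2`**: the reflex field of a near-bent type is `K`
> itself or a subfield of index `2`.
> **Theorem** (`hodgeConjectureFor_pow_of_natCard_twistStabilizer_eq_two`, `forall_hodgeClassSpan_eq_of_…`).  **If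
> `|Stab(Φ)| = 2` (the imprimitive near-bent types: the concatenations `f ‖ f` of a bent type of the index-`2`
> subfield), then for EVERY abelian variety `A` of type `(K; Φ)`: `Bᵐ(A) ⊗ ℂ = Dᵐ(A) ⊗ ℂ` for all `m` and THE HODGE
> CONJECTURE HOLDS FOR EVERY POWER `Aⁿ`**; such `A` is not simple.  Such types exist in every square degree
> (`exists_nearBent_natCard_twistStabilizer_eq_two`).
> **Theorem** (`isSimple_and_exists_exceptional_of_natCard_twistStabilizer_eq_one`).  **If `|Stab(Φ)| = 1` (primitive
> near-bent), then `[K:ℚ] ≥ 64` and every abelian variety `A` of type `(K; Φ)` is SIMPLE, of dimension `[K:ℚ]/2 ≥ 32`,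
> and carries an exceptional Hodge class** (a rational `(m,m)`-class outside `Dᵐ(A) ⊗ ℂ`) — the Hodge conjecture for
> these is not decided here.
> **Instances.**  Degree `16`: near-bent ⟺ `Rank(Φ) = 5`; exactly `112` near-bent types, all with `|Stab| = 2` (their
> powers satisfy the Hodge conjecture — the tree's rank-`5` theorem recovered).  Degree `64`: near-bent types exist and
> have `Rank(Φ) = 17`; the dichotomy above is `|Stab| = 2` (Hodge conjecture for all powers) versus `|Stab| = 1`
> (simple `32`-folds with exceptional Hodge classes).

* §0 dictionary helpers (`T` is a group-level CM type, `|G| = [K:ℚ]`, `|Stab(Φ)| = |Stab(T)|`, an even character with a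
  prescribed sign).
* §1 **rank, degree, stabiliser**: **`four_mul_cmTypeRank_sub_one_eq`**, `cmTypeRank_lt`, **`isSquare_finrank`**,
  **`exists_nearBent_iff_isSquare_finrank`**, **`natCard_twistStabilizer_le_two`**, `natCard_twistStabilizer_eq_one_or_two`.
* §2 **the imprimitive case** (`|Stab(Φ)| = 2`): `two_mul_natCard_twistStabilizer_mul_eq`,
  **`forall_hodgeClassSpan_eq_of_natCard_twistStabilizer_eq_two`**,
  **`hodgeConjectureFor_pow_of_natCard_twistStabilizer_eq_two`**, `not_isSimple_of_natCard_twistStabilizer_eq_two`,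
  `natCard_twistStabilizer_eq_two_of_mem`, `hodgeConjectureFor_pow_of_mem_twistStabilizer`,
  **`exists_nearBent_natCard_twistStabilizer_eq_two`**.
* §3 **the primitive case** (`|Stab(Φ)| = 1`): `two_mul_natCard_twistStabilizer_mul_lt`,
  **`isSimple_and_exists_exceptional_of_natCard_twistStabilizer_eq_one`**, `sixtyFour_le_finrank_of_natCard_twistStabilizer_eq_one`,
  the dichotomy `hodgeConjectureFor_pow_or_exists_exceptional`.
* §4 degrees `16` and `64`.

HONEST SCOPE.  Assembly of the tree's group-level near-bent theory with the tree's abelian-CM-field Hodge dictionary;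
no named fact.  "Near-bent" depends on the base embedding `φ₀` only through a translation of `T` (not proved here; every
statement carries `φ₀`).  The primitive case is reported as "exceptional Hodge classes exist" — whether they are
algebraic (the Hodge conjecture for these simple `2ⁿ`-folds, `n ≥ 5` odd) is NOT addressed, and no primitive near-bent
type is constructed.  THEOREMS ONLY: no definition, no named fact, no instance, no `sorry`.

## References

* [Kubota1965] T. Kubota, *On the field extension by complex multiplication*, Trans. AMS 118 (1965), §2, §4 Lemma 2.
* [Shimura1998] G. Shimura, *Abelian Varieties with Complex Multiplication and Modular Functions*, §8.4 Example (1),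
  §32.10.
* [Pohlmann1968] H. Pohlmann, *Algebraic cycles on abelian varieties of complex multiplication type*, Ann. of Math. 88
  (1968), Thm. 1.
* [Gordon1999HodgeAVSurvey] B. B. Gordon, *A survey of the Hodge conjecture for abelian varieties*, Prop. 9.4.1,
  Thm. 6.4, §9.2–9.3.
* [White1993SporadicCycles] S. P. White, *Sporadic cycles on CM abelian varieties*, Compositio Math. 88 (1993), §4 Thm. 3.
* [Carlet2020] C. Carlet, *Boolean Functions for Cryptography and Coding Theory*, CUP (2020), §6.2.4, §3.1 p. 81.
* [Dodson1984] B. Dodson, *The structure of Galois groups of CM-fields*, Trans. AMS 283 (1984), §3.1.1.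

## Provenance

Lane `lit-hodgefound` (Track 2, Layer A3/A5), seat `lit-hodgefound-p10` generation 43, row g43-#5; neighbours cited by
name, nothing restated: `DegenerateCMTypesElementaryAbelianNearBentTypes` / `…NearBentTypesStabilizer` (g43-#3/#4,
USED), `AbelianCMFieldStabilizerCharacterCriterion` (`natCard_twistStabilizer_eq_card_stabilizer`,
`mem_twistStabilizer_iff_forall_mul_mem_iff`, USED), `AbelianCMFieldSurvivorTernaryCriterion`
(`two_mul_card_stabilizer_mul_eq_iff_two_mul_natCard_twistStabilizer_mul_eq`, USED), `AbelianCMFieldStabilizerExceptionalClasses`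
(`two_mul_natCard_twistStabilizer_mul_eq_iff_forall_hodgeClassSpan_eq`, `exists_exceptional_of_two_mul_natCard_twistStabilizer_mul_lt`,
USED), `CMTypeRankStabilizerBound` (`hodgeConjectureFor_pow_of_two_mul_natCard_twistStabilizer_mul_eq`, USED),
`SimpleIffPrimitiveCMType` (`isSimple_iff_primitive`), `CMTypeEquivalenceClassesCount`
(`pattern_primitive_iff_twistStabilizer_eq_bot`), `DegenerateCMTypesCyclicCMFieldTwoOddPrimes`
(`isCMTypeWith_galType`, `cmTypeRank_eq_typeRank_galType`, `exists_cmType_of_isCMTypeWith`),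
`DegenerateCMTypesCyclicCMFieldPrimeSquare` (`ncard_cmType_sep_eq`), `MultiquadraticCMFieldRankFiveCensus`
(`ncard_cmTypeRank_eq_five_of_finrank_eq_sixteen`), `NondegenerateCMTypeExistenceAbelianField` (`apply_conjGal_eq`),
`SimpleDegenerateCMAbelianVarietiesCompositeDimension` (`conjGalElt_ne_one`, `card_gal_eq_finrank`), Mathlib
`Subgroup.card_eq_one`, `AddChar.exists_apply_ne_zero`.
-/

open scoped BigOperators NumberField IsMulCommutative Classical
open NumberField Module CategoryTheory CategoryTheory.Limits IntermediateField

namespace Literature.AlgebraicGeometry.Pohlmann1968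

namespace MultiquadraticNearBent

open scoped Literature.NumberTheory.ComplexMultiplication
open Literature.NumberTheory.ComplexMultiplication (twistStabilizer typeRank IsCMTypeWith conjGal
  character_apply_eq_one_or_of_mul_self pattern_primitive_iff_twistStabilizer_eq_bot)
open Literature.NumberTheory.ComplexMultiplication.CyclicCMType.ExponentTwo.NearBentTypes
  (four_mul_typeRank_sub_one_eq typeRank_lt isSquare_card exists_nearBent_iff_isSquare two_mul_card_filter_eq_zero
  nearBent_iff_typeRank_eq_five_of_card_eq_sixteen two_mul_typeRank_eq)
open Literature.NumberTheory.ComplexMultiplication.CyclicCMType.ExponentTwo.NearBentTypesStabilizer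
  (card_stabilizer_le_two two_mul_card_stabilizer_mul_eq_iff_card_eq_two exists_nearBent_stabilizer_eq_pair
  sixtyFour_le_card_of_card_stabilizer_eq_one card_stabilizer_eq_two_of_card_eq_sixteen)
open Literature.AlgebraicGeometry.Pohlmann1968.CyclicTwoOddPrimes (isCMTypeWith_galType
  cmTypeRank_eq_typeRank_galType exists_cmType_of_isCMTypeWith)
open Literature.AlgebraicGeometry.Motives (CMType AbelianVariety)
open Literature.AlgebraicGeometry.HodgeTheory
open Literature.AlgebraicGeometry.VanGeemen1994 (hodgeClassSpan)
open Literature.Barriers.HodgeConjecture (divisorClassesSpan)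
open Literature.AlgebraicGeometry.ComplexMultiplication (IsCMTypeRealisation isSimple_iff_primitive)

variable {K : Type} [Field K] [NumberField K] [IsCMField K] [IsGalois ℚ K]
  {A : AbelianVariety ℂ} {ι : 𝓞 K →+* End A} {θ : K →+* Module.End ℂ (complexBetti A.X 1)}

/-! ## §0 Dictionary helpers -/

section Helpers

omit [IsGalois ℚ K] in
/-- `σ_{ρg} = σ̄_g` under the base embedding. [cite: Shimura1998, §18.2 Lemma (i)] -/
private theorem apply_conjGal_eq_fn (φ₀ : K →+* ℂ) (x : K) :
    φ₀ ((conjGal : K ≃ₐ[ℚ] K) x) = starRingEnd ℂ (φ₀ x) :=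
  AbelianCMFieldExistence.apply_conjGal_eq φ₀ x

/-- The group-level type `T = {g : σ_g ∈ Φ}` is a CM type of `Gal(K/ℚ)` w.r.t. `ρ` (abelian `K`).
[cite: Shimura1998, §8.1] [cite: Kubota1965, §2] -/
private theorem isCMTypeWith_T_fn (hexp : ∀ g : K ≃ₐ[ℚ] K, g ^ 2 = 1) (φ₀ : K →+* ℂ) (Φ : CMType K) :
    IsCMTypeWith (conjGal : K ≃ₐ[ℚ] K)
      (↑(Finset.univ.filter fun s : K ≃ₐ[ℚ] K => embOf φ₀ s ∈ Φ.1) : Set (K ≃ₐ[ℚ] K)) := by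
  haveI := Multiquadratic.isAbelianGalois_of_forall_sq_eq_one hexp
  exact isCMTypeWith_galType (apply_conjGal_eq_fn φ₀) Φ

omit [IsGalois ℚ K] in
/-- `ρ ≠ 1`. [cite: Shimura1998, §18.2 Lemma (i)] -/
private theorem conjGal_ne_one_fn (φ₀ : K →+* ℂ) : (conjGal : K ≃ₐ[ℚ] K) ≠ 1 :=
  conjGalElt_ne_one (apply_conjGal_eq_fn φ₀)

omit [IsCMField K] in
/-- `|Stab(Φ)| = |Stab(T)|` (abelian `K`). [cite: Kubota1965, §4 Lemma 2] [cite: Shimura1998, §8.4 Example (1)] -/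
private theorem natCard_eq_fn (hexp : ∀ g : K ≃ₐ[ℚ] K, g ^ 2 = 1) (φ₀ : K →+* ℂ) (Φ : CMType K) :
    Nat.card (twistStabilizer Φ) =
      (Finset.univ.filter fun g : K ≃ₐ[ℚ] K => ∀ t : K ≃ₐ[ℚ] K,
        t * g ∈ (Finset.univ.filter fun s : K ≃ₐ[ℚ] K => embOf φ₀ s ∈ Φ.1) ↔
          t ∈ (Finset.univ.filter fun s : K ≃ₐ[ℚ] K => embOf φ₀ s ∈ Φ.1)).card := by
  haveI := Multiquadratic.isAbelianGalois_of_forall_sq_eq_one hexp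
  exact natCard_twistStabilizer_eq_card_stabilizer φ₀ Φ

omit [IsCMField K] in
/-- Characters of a group of exponent `2` are `±1`-valued. [folklore] -/
private theorem char_eq_one_or_fn (hexp : ∀ g : K ≃ₐ[ℚ] K, g ^ 2 = 1) (χ : AddChar (Additive (K ≃ₐ[ℚ] K)) ℂ)
    (g : K ≃ₐ[ℚ] K) : χ (Additive.ofMul g) = 1 ∨ χ (Additive.ofMul g) = -1 := by
  haveI := Multiquadratic.isAbelianGalois_of_forall_sq_eq_one hexp
  have hg : g * g = 1 := by rw [← pow_two]; exact hexp g
  exact character_apply_eq_one_or_of_mul_self χ hg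

omit [IsCMField K] in
/-- For `a ≠ 1` there is a character with `χ(a) = −1` (Mathlib `AddChar.exists_apply_ne_zero`). [folklore] -/
private theorem exists_char_fn (hexp : ∀ g : K ≃ₐ[ℚ] K, g ^ 2 = 1) {a : K ≃ₐ[ℚ] K} (ha : a ≠ 1) :
    ∃ χ : AddChar (Additive (K ≃ₐ[ℚ] K)) ℂ, χ (Additive.ofMul a) = -1 := by
  haveI := Multiquadratic.isAbelianGalois_of_forall_sq_eq_one hexp
  have ha0 : Additive.ofMul a ≠ 0 := fun h => ha (by simpa using congrArg Additive.toMul h)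
  obtain ⟨χ, hχ⟩ := (AddChar.exists_apply_ne_zero (α := Additive (K ≃ₐ[ℚ] K))).2 ha0
  exact ⟨χ, (char_eq_one_or_fn hexp χ a).resolve_left hχ⟩

omit [IsCMField K] in
/-- An EVEN character (`ψ(ρ) = 1`) with `ψ(a) = −1`, for `a ∉ {1, ρ}`. [folklore] -/
private theorem exists_even_char_fn (hexp : ∀ g : K ≃ₐ[ℚ] K, g ^ 2 = 1) {ρ a : K ≃ₐ[ℚ] K} (ha1 : a ≠ 1)
    (haρ : a ≠ ρ) :
    ∃ ψ : AddChar (Additive (K ≃ₐ[ℚ] K)) ℂ, ψ (Additive.ofMul ρ) = 1 ∧ ψ (Additive.ofMul a) = -1 := by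
  haveI := Multiquadratic.isAbelianGalois_of_forall_sq_eq_one hexp
  obtain ⟨φ, hφ⟩ := exists_char_fn hexp ha1
  rcases char_eq_one_or_fn hexp φ ρ with hφρ | hφρ
  · exact ⟨φ, hφρ, hφ⟩
  have hρρ : ρ * ρ = 1 := by rw [← pow_two]; exact hexp ρ
  have haρ1 : a * ρ ≠ 1 := fun h => haρ (mul_right_cancel (h.trans hρρ.symm))
  obtain ⟨φ', hφ'⟩ := exists_char_fn hexp haρ1
  rw [ofMul_mul, AddChar.map_add_eq_mul] at hφ'
  rcases char_eq_one_or_fn hexp φ' ρ with hφ'ρ | hφ'ρ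
  · rw [hφ'ρ, mul_one] at hφ'
    exact ⟨φ', hφ'ρ, hφ'⟩
  · rw [hφ'ρ] at hφ'
    refine ⟨φ + φ', ?_, ?_⟩
    · rw [AddChar.add_apply, hφρ, hφ'ρ]; norm_num
    · rw [AddChar.add_apply, hφ]
      linear_combination hφ'

end Helpers

/-! ## §1 Rank, degree and stabiliser of a near-bent CM type -/

section Rank

/-- **`Rank(Φ) = [K:ℚ]/4 + 1` FOR A NEAR-BENT CM TYPE**: `4·(Rank(Φ) − 1) = [K:ℚ]` (Kubota: `rank = 1 + #`surviving
odd characters, and exactly half of the `[K:ℚ]/2` odd characters survive). [cite: Kubota1965, §4 Lemma 2]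
[cite: Carlet2020, §6.2.4] -/
theorem four_mul_cmTypeRank_sub_one_eq (hexp : ∀ g : K ≃ₐ[ℚ] K, g ^ 2 = 1) (φ₀ : K →+* ℂ) (Φ : CMType K)
    (hnb : ∀ χ : AddChar (Additive (K ≃ₐ[ℚ] K)) ℂ, χ (Additive.ofMul (conjGal : K ≃ₐ[ℚ] K)) = -1 →
      ∑ s ∈ (Finset.univ.filter fun s : K ≃ₐ[ℚ] K => embOf φ₀ s ∈ Φ.1), χ (Additive.ofMul s) = 0 ∨
        (∑ s ∈ (Finset.univ.filter fun s : K ≃ₐ[ℚ] K => embOf φ₀ s ∈ Φ.1), χ (Additive.ofMul s)) ^ 2 =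
          2 * ((Finset.univ.filter fun s : K ≃ₐ[ℚ] K => embOf φ₀ s ∈ Φ.1).card : ℂ)) :
    4 * (cmTypeRank Φ - 1) = finrank ℚ K := by
  haveI := Multiquadratic.isAbelianGalois_of_forall_sq_eq_one hexp
  rw [cmTypeRank_eq_typeRank_galType Φ φ₀, ← card_gal_eq_finrank φ₀]
  exact four_mul_typeRank_sub_one_eq hexp (isCMTypeWith_T_fn hexp φ₀ Φ) hnb

/-- **A near-bent type is degenerate**: `Rank(Φ) < [K:ℚ]/2 + 1`. [cite: Kubota1965, §4 Lemma 2] -/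
theorem cmTypeRank_lt (hexp : ∀ g : K ≃ₐ[ℚ] K, g ^ 2 = 1) (φ₀ : K →+* ℂ) (Φ : CMType K)
    (hnb : ∀ χ : AddChar (Additive (K ≃ₐ[ℚ] K)) ℂ, χ (Additive.ofMul (conjGal : K ≃ₐ[ℚ] K)) = -1 →
      ∑ s ∈ (Finset.univ.filter fun s : K ≃ₐ[ℚ] K => embOf φ₀ s ∈ Φ.1), χ (Additive.ofMul s) = 0 ∨
        (∑ s ∈ (Finset.univ.filter fun s : K ≃ₐ[ℚ] K => embOf φ₀ s ∈ Φ.1), χ (Additive.ofMul s)) ^ 2 =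
          2 * ((Finset.univ.filter fun s : K ≃ₐ[ℚ] K => embOf φ₀ s ∈ Φ.1).card : ℂ)) :
    cmTypeRank Φ < finrank ℚ K / 2 + 1 := by
  haveI := Multiquadratic.isAbelianGalois_of_forall_sq_eq_one hexp
  rw [cmTypeRank_eq_typeRank_galType Φ φ₀, ← card_gal_eq_finrank φ₀]
  exact typeRank_lt hexp (isCMTypeWith_T_fn hexp φ₀ Φ) hnb

/-- **A NEAR-BENT TYPE FORCES `[K:ℚ]` TO BE A PERFECT SQUARE** (odd dimension `n`, `[K:ℚ] = 2ⁿ⁺¹ = 4^{(n+1)/2}`).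
[cite: Carlet2020, §6.2.2 Definition 63 and §6.2.4] [cite: Kubota1965, §4 Lemma 2] -/
theorem isSquare_finrank (hexp : ∀ g : K ≃ₐ[ℚ] K, g ^ 2 = 1) (φ₀ : K →+* ℂ) (Φ : CMType K)
    (hnb : ∀ χ : AddChar (Additive (K ≃ₐ[ℚ] K)) ℂ, χ (Additive.ofMul (conjGal : K ≃ₐ[ℚ] K)) = -1 →
      ∑ s ∈ (Finset.univ.filter fun s : K ≃ₐ[ℚ] K => embOf φ₀ s ∈ Φ.1), χ (Additive.ofMul s) = 0 ∨
        (∑ s ∈ (Finset.univ.filter fun s : K ≃ₐ[ℚ] K => embOf φ₀ s ∈ Φ.1), χ (Additive.ofMul s)) ^ 2 =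
          2 * ((Finset.univ.filter fun s : K ≃ₐ[ℚ] K => embOf φ₀ s ∈ Φ.1).card : ℂ)) :
    IsSquare (finrank ℚ K) := by
  haveI := Multiquadratic.isAbelianGalois_of_forall_sq_eq_one hexp
  rw [← card_gal_eq_finrank φ₀]
  exact isSquare_card hexp (isCMTypeWith_T_fn hexp φ₀ Φ) hnb

/-- **A MULTIQUADRATIC CM FIELD HAS NEAR-BENT CM TYPES IFF ITS DEGREE IS A PERFECT SQUARE** (⟸: the bent
concatenation inside `Gal(K/ℚ)`, tree `NearBentTypes.exists_nearBent_iff_isSquare`; the group-level type is realised by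
a CM type of `K`, tree `exists_cmType_of_isCMTypeWith`). [cite: Carlet2020, §3.1 p. 81 and §6.2.4]
[cite: Shimura1998, §8.1] [cite: Kubota1965, §4 Lemma 2] -/
theorem exists_nearBent_iff_isSquare_finrank (hexp : ∀ g : K ≃ₐ[ℚ] K, g ^ 2 = 1) (φ₀ : K →+* ℂ) :
    (∃ Φ : CMType K,
      ∀ χ : AddChar (Additive (K ≃ₐ[ℚ] K)) ℂ, χ (Additive.ofMul (conjGal : K ≃ₐ[ℚ] K)) = -1 →
        ∑ s ∈ (Finset.univ.filter fun s : K ≃ₐ[ℚ] K => embOf φ₀ s ∈ Φ.1), χ (Additive.ofMul s) = 0 ∨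
          (∑ s ∈ (Finset.univ.filter fun s : K ≃ₐ[ℚ] K => embOf φ₀ s ∈ Φ.1), χ (Additive.ofMul s)) ^ 2 =
            2 * ((Finset.univ.filter fun s : K ≃ₐ[ℚ] K => embOf φ₀ s ∈ Φ.1).card : ℂ)) ↔
      IsSquare (finrank ℚ K) := by
  haveI := Multiquadratic.isAbelianGalois_of_forall_sq_eq_one hexp
  constructor
  · rintro ⟨Φ, hnb⟩
    exact isSquare_finrank hexp φ₀ Φ hnb
  · intro hsq
    rw [← card_gal_eq_finrank φ₀] at hsq
    obtain ⟨T, hT, hnb⟩ := (exists_nearBent_iff_isSquare hexp (conjGal_ne_one_fn φ₀)).2 hsq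
    obtain ⟨Φ, hΦ⟩ := exists_cmType_of_isCMTypeWith (apply_conjGal_eq_fn φ₀) hT
    refine ⟨Φ, ?_⟩
    rw [hΦ]
    exact hnb

/-- **`|Stab(Φ)| ≤ 2` FOR A NEAR-BENT CM TYPE** — the reflex field `K*` (`Gal(K/K*) = Stab(Φ)`) is `K` or a subfield
of index `2` (the reflex bound `2·|Stab|·(Rank − 1) ≤ [K:ℚ]` with `Rank − 1 = [K:ℚ]/4`). [cite: Shimura1998, §32.10]
[cite: Shimura1998, §8.4 Example (1)] [cite: Kubota1965, §4 Lemma 2] -/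
theorem natCard_twistStabilizer_le_two (hexp : ∀ g : K ≃ₐ[ℚ] K, g ^ 2 = 1) (φ₀ : K →+* ℂ) (Φ : CMType K)
    (hnb : ∀ χ : AddChar (Additive (K ≃ₐ[ℚ] K)) ℂ, χ (Additive.ofMul (conjGal : K ≃ₐ[ℚ] K)) = -1 →
      ∑ s ∈ (Finset.univ.filter fun s : K ≃ₐ[ℚ] K => embOf φ₀ s ∈ Φ.1), χ (Additive.ofMul s) = 0 ∨
        (∑ s ∈ (Finset.univ.filter fun s : K ≃ₐ[ℚ] K => embOf φ₀ s ∈ Φ.1), χ (Additive.ofMul s)) ^ 2 =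
          2 * ((Finset.univ.filter fun s : K ≃ₐ[ℚ] K => embOf φ₀ s ∈ Φ.1).card : ℂ)) :
    Nat.card (twistStabilizer Φ) ≤ 2 := by
  haveI := Multiquadratic.isAbelianGalois_of_forall_sq_eq_one hexp
  rw [natCard_eq_fn hexp φ₀ Φ]
  exact card_stabilizer_le_two hexp (isCMTypeWith_T_fn hexp φ₀ Φ) hnb

/-- **`|Stab(Φ)| = 1` or `2`** for a near-bent type. [cite: Shimura1998, §32.10] [cite: Kubota1965, §4 Lemma 2] -/
theorem natCard_twistStabilizer_eq_one_or_two (hexp : ∀ g : K ≃ₐ[ℚ] K, g ^ 2 = 1) (φ₀ : K →+* ℂ) (Φ : CMType K)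
    (hnb : ∀ χ : AddChar (Additive (K ≃ₐ[ℚ] K)) ℂ, χ (Additive.ofMul (conjGal : K ≃ₐ[ℚ] K)) = -1 →
      ∑ s ∈ (Finset.univ.filter fun s : K ≃ₐ[ℚ] K => embOf φ₀ s ∈ Φ.1), χ (Additive.ofMul s) = 0 ∨
        (∑ s ∈ (Finset.univ.filter fun s : K ≃ₐ[ℚ] K => embOf φ₀ s ∈ Φ.1), χ (Additive.ofMul s)) ^ 2 =
          2 * ((Finset.univ.filter fun s : K ≃ₐ[ℚ] K => embOf φ₀ s ∈ Φ.1).card : ℂ)) :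
    Nat.card (twistStabilizer Φ) = 1 ∨ Nat.card (twistStabilizer Φ) = 2 := by
  have hle := natCard_twistStabilizer_le_two hexp φ₀ Φ hnb
  have hpos : 0 < Nat.card (twistStabilizer Φ) := Nat.card_pos
  omega

end Rank

/-! ## §2 The imprimitive case `|Stab(Φ)| = 2`: the Hodge conjecture for all powers -/

section Imprimitive

/-- **`|Stab(Φ)| = 2` ⟹ THE REFLEX BOUND IS AN EQUALITY**: `2·|Stab(Φ)|·(Rank(Φ) − 1) = [K:ℚ]`.
[cite: Shimura1998, §32.10] [cite: Kubota1965, §4 Lemma 2] -/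
theorem two_mul_natCard_twistStabilizer_mul_eq (hexp : ∀ g : K ≃ₐ[ℚ] K, g ^ 2 = 1) (φ₀ : K →+* ℂ)
    (Φ : CMType K)
    (hnb : ∀ χ : AddChar (Additive (K ≃ₐ[ℚ] K)) ℂ, χ (Additive.ofMul (conjGal : K ≃ₐ[ℚ] K)) = -1 →
      ∑ s ∈ (Finset.univ.filter fun s : K ≃ₐ[ℚ] K => embOf φ₀ s ∈ Φ.1), χ (Additive.ofMul s) = 0 ∨
        (∑ s ∈ (Finset.univ.filter fun s : K ≃ₐ[ℚ] K => embOf φ₀ s ∈ Φ.1), χ (Additive.ofMul s)) ^ 2 =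
          2 * ((Finset.univ.filter fun s : K ≃ₐ[ℚ] K => embOf φ₀ s ∈ Φ.1).card : ℂ))
    (h2 : Nat.card (twistStabilizer Φ) = 2) :
    2 * Nat.card (twistStabilizer Φ) * (cmTypeRank Φ - 1) = finrank ℚ K := by
  have h4 := four_mul_cmTypeRank_sub_one_eq hexp φ₀ Φ hnb
  rw [h2]
  omega

/-- **`|Stab(Φ)| = 2` ⟹ `Bᵐ(A) ⊗ ℂ = Dᵐ(A) ⊗ ℂ` FOR ALL `m`** on every abelian variety `A` of type `(K; Φ)`, `Φ`
near-bent (Hazama's equality case; tree `two_mul_natCard_twistStabilizer_mul_eq_iff_forall_hodgeClassSpan_eq`).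
[cite: Gordon1999HodgeAVSurvey, Thm. 6.4] [cite: Pohlmann1968, Thm. 1] [cite: Kubota1965, §4 Lemma 2] -/
theorem forall_hodgeClassSpan_eq_of_natCard_twistStabilizer_eq_two (hexp : ∀ g : K ≃ₐ[ℚ] K, g ^ 2 = 1)
    (φ₀ : K →+* ℂ) (Φ : CMType K)
    (hnb : ∀ χ : AddChar (Additive (K ≃ₐ[ℚ] K)) ℂ, χ (Additive.ofMul (conjGal : K ≃ₐ[ℚ] K)) = -1 →
      ∑ s ∈ (Finset.univ.filter fun s : K ≃ₐ[ℚ] K => embOf φ₀ s ∈ Φ.1), χ (Additive.ofMul s) = 0 ∨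
        (∑ s ∈ (Finset.univ.filter fun s : K ≃ₐ[ℚ] K => embOf φ₀ s ∈ Φ.1), χ (Additive.ofMul s)) ^ 2 =
          2 * ((Finset.univ.filter fun s : K ≃ₐ[ℚ] K => embOf φ₀ s ∈ Φ.1).card : ℂ))
    (h2 : Nat.card (twistStabilizer Φ) = 2) (hA : IsCMTypeRealisation Φ A ι θ) :
    ∀ m : ℕ, hodgeClassSpan (finrank ℚ K / 2) A.X m = divisorClassesSpan A.X (finrank ℚ K / 2) m := by
  haveI := Multiquadratic.isAbelianGalois_of_forall_sq_eq_one hexp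
  exact (two_mul_natCard_twistStabilizer_mul_eq_iff_forall_hodgeClassSpan_eq Φ hA).1
    (two_mul_natCard_twistStabilizer_mul_eq hexp φ₀ Φ hnb h2)

/-- **`|Stab(Φ)| = 2` ⟹ THE HODGE CONJECTURE FOR EVERY POWER `Aⁿ`** of every abelian variety `A` of type `(K; Φ)`,
`Φ` near-bent — the imprimitive near-bent types (the concatenations `f ‖ f` of a bent type of the index-`2` subfield)
are induced from a nondegenerate type, and the Pohlmann–Hazama transfer applies (tree
`hodgeConjectureFor_pow_of_two_mul_natCard_twistStabilizer_mul_eq`). [cite: Gordon1999HodgeAVSurvey, Thm. 6.4 and §9.3]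
[cite: Pohlmann1968, Thm. 1] [cite: Shimura1998, §32.10] -/
theorem hodgeConjectureFor_pow_of_natCard_twistStabilizer_eq_two (hexp : ∀ g : K ≃ₐ[ℚ] K, g ^ 2 = 1)
    (φ₀ : K →+* ℂ) (Φ : CMType K)
    (hnb : ∀ χ : AddChar (Additive (K ≃ₐ[ℚ] K)) ℂ, χ (Additive.ofMul (conjGal : K ≃ₐ[ℚ] K)) = -1 →
      ∑ s ∈ (Finset.univ.filter fun s : K ≃ₐ[ℚ] K => embOf φ₀ s ∈ Φ.1), χ (Additive.ofMul s) = 0 ∨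
        (∑ s ∈ (Finset.univ.filter fun s : K ≃ₐ[ℚ] K => embOf φ₀ s ∈ Φ.1), χ (Additive.ofMul s)) ^ 2 =
          2 * ((Finset.univ.filter fun s : K ≃ₐ[ℚ] K => embOf φ₀ s ∈ Φ.1).card : ℂ))
    (h2 : Nat.card (twistStabilizer Φ) = 2) (hA : IsCMTypeRealisation Φ A ι θ) (n : ℕ) :
    HodgeConjectureFor (⨁ fun _ : Fin n => A).dim (⨁ fun _ : Fin n => A).X :=
  hodgeConjectureFor_pow_of_two_mul_natCard_twistStabilizer_mul_eq Φ
    (two_mul_natCard_twistStabilizer_mul_eq hexp φ₀ Φ hnb h2) hA n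

omit [IsCMField K] in
/-- **`|Stab(Φ)| = 2` ⟹ `A` IS NOT SIMPLE** (`Φ` is induced from the index-`2` subfield `K^{Stab(Φ)}`; simple ⟺
primitive ⟺ `Stab(Φ) = 1`, tree `isSimple_iff_primitive`, `pattern_primitive_iff_twistStabilizer_eq_bot`).
[cite: Shimura1998, §8.2 Prop. 26 and §8.4 Example (1)] -/
theorem not_isSimple_of_natCard_twistStabilizer_eq_two (Φ : CMType K) (h2 : Nat.card (twistStabilizer Φ) = 2)
    (hA : IsCMTypeRealisation Φ A ι θ) : ¬ A.IsSimple := by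
  intro hS
  have hbot := (pattern_primitive_iff_twistStabilizer_eq_bot Φ).1 ((isSimple_iff_primitive hA).1 hS)
  have h1 : Nat.card (twistStabilizer Φ) = 1 := by rw [hbot]; exact Subgroup.card_bot
  omega

/-- A near-bent type with a non-trivial element in its stabiliser has `|Stab(Φ)| = 2`.
[cite: Shimura1998, §8.4 Example (1) and §32.10] -/
theorem natCard_twistStabilizer_eq_two_of_mem (hexp : ∀ g : K ≃ₐ[ℚ] K, g ^ 2 = 1) (φ₀ : K →+* ℂ) (Φ : CMType K)
    (hnb : ∀ χ : AddChar (Additive (K ≃ₐ[ℚ] K)) ℂ, χ (Additive.ofMul (conjGal : K ≃ₐ[ℚ] K)) = -1 →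
      ∑ s ∈ (Finset.univ.filter fun s : K ≃ₐ[ℚ] K => embOf φ₀ s ∈ Φ.1), χ (Additive.ofMul s) = 0 ∨
        (∑ s ∈ (Finset.univ.filter fun s : K ≃ₐ[ℚ] K => embOf φ₀ s ∈ Φ.1), χ (Additive.ofMul s)) ^ 2 =
          2 * ((Finset.univ.filter fun s : K ≃ₐ[ℚ] K => embOf φ₀ s ∈ Φ.1).card : ℂ))
    {g : K ≃ₐ[ℚ] K} (hg1 : g ≠ 1) (hg : g ∈ twistStabilizer Φ) : Nat.card (twistStabilizer Φ) = 2 := by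
  have hle := natCard_twistStabilizer_le_two hexp φ₀ Φ hnb
  have hne : Nat.card (twistStabilizer Φ) ≠ 1 := by
    intro h1
    have hbot := (Subgroup.card_eq_one.1 h1)
    rw [hbot] at hg
    exact hg1 (Subgroup.mem_bot.1 hg)
  have hpos : 0 < Nat.card (twistStabilizer Φ) := Nat.card_pos
  omega

/-- **`Φg = Φ` for some `g ≠ 1` (near-bent `Φ`) ⟹ THE HODGE CONJECTURE FOR EVERY POWER of every abelian variety of
type `(K; Φ)`.** [cite: Gordon1999HodgeAVSurvey, Thm. 6.4 and §9.3] [cite: Shimura1998, §32.10] -/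
theorem hodgeConjectureFor_pow_of_mem_twistStabilizer (hexp : ∀ g : K ≃ₐ[ℚ] K, g ^ 2 = 1) (φ₀ : K →+* ℂ)
    (Φ : CMType K)
    (hnb : ∀ χ : AddChar (Additive (K ≃ₐ[ℚ] K)) ℂ, χ (Additive.ofMul (conjGal : K ≃ₐ[ℚ] K)) = -1 →
      ∑ s ∈ (Finset.univ.filter fun s : K ≃ₐ[ℚ] K => embOf φ₀ s ∈ Φ.1), χ (Additive.ofMul s) = 0 ∨
        (∑ s ∈ (Finset.univ.filter fun s : K ≃ₐ[ℚ] K => embOf φ₀ s ∈ Φ.1), χ (Additive.ofMul s)) ^ 2 =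
          2 * ((Finset.univ.filter fun s : K ≃ₐ[ℚ] K => embOf φ₀ s ∈ Φ.1).card : ℂ))
    {g : K ≃ₐ[ℚ] K} (hg1 : g ≠ 1) (hg : g ∈ twistStabilizer Φ) (hA : IsCMTypeRealisation Φ A ι θ) (n : ℕ) :
    HodgeConjectureFor (⨁ fun _ : Fin n => A).dim (⨁ fun _ : Fin n => A).X :=
  hodgeConjectureFor_pow_of_natCard_twistStabilizer_eq_two hexp φ₀ Φ hnb
    (natCard_twistStabilizer_eq_two_of_mem hexp φ₀ Φ hnb hg1 hg) hA n

/-- **NEAR-BENT CM TYPES WITH `|Stab(Φ)| = 2` EXIST IN EVERY SQUARE DEGREE** `[K:ℚ] = 4ᵏ⁺¹`: the `f ‖ f`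
concatenation inside `Gal(K/ℚ)` (tree `NearBentTypesStabilizer.exists_nearBent_stabilizer_eq_pair`) realised by a CM
type of `K`; all powers of all their abelian varieties satisfy the Hodge conjecture (previous theorem).
[cite: Carlet2020, §3.1 p. 81] [cite: Shimura1998, §8.1 and §32.10] [cite: Kubota1965, §4 Lemma 2] -/
theorem exists_nearBent_natCard_twistStabilizer_eq_two (hexp : ∀ g : K ≃ₐ[ℚ] K, g ^ 2 = 1) (φ₀ : K →+* ℂ)
    {k : ℕ} (hK : finrank ℚ K = 4 ^ (k + 1)) :
    ∃ Φ : CMType K,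
      (∀ χ : AddChar (Additive (K ≃ₐ[ℚ] K)) ℂ, χ (Additive.ofMul (conjGal : K ≃ₐ[ℚ] K)) = -1 →
        ∑ s ∈ (Finset.univ.filter fun s : K ≃ₐ[ℚ] K => embOf φ₀ s ∈ Φ.1), χ (Additive.ofMul s) = 0 ∨
          (∑ s ∈ (Finset.univ.filter fun s : K ≃ₐ[ℚ] K => embOf φ₀ s ∈ Φ.1), χ (Additive.ofMul s)) ^ 2 =
            2 * ((Finset.univ.filter fun s : K ≃ₐ[ℚ] K => embOf φ₀ s ∈ Φ.1).card : ℂ)) ∧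
      Nat.card (twistStabilizer Φ) = 2 := by
  haveI := Multiquadratic.isAbelianGalois_of_forall_sq_eq_one hexp
  have hcard : Fintype.card (K ≃ₐ[ℚ] K) = 4 ^ (k + 1) := by rw [card_gal_eq_finrank φ₀, hK]
  -- an element `a ∉ {1, ρ}` and an even character `ψ` with `ψ(a) = −1`
  have h4 : 4 ≤ Fintype.card (K ≃ₐ[ℚ] K) := by
    rw [hcard, pow_succ]
    have : 1 ≤ 4 ^ k := Nat.one_le_pow _ _ (by norm_num)
    omega
  obtain ⟨a, -, ha⟩ : ∃ a ∈ (Finset.univ : Finset (K ≃ₐ[ℚ] K)),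
      a ∉ ({1, (conjGal : K ≃ₐ[ℚ] K)} : Finset (K ≃ₐ[ℚ] K)) :=
    Finset.exists_mem_notMem_of_card_lt_card
      (lt_of_le_of_lt Finset.card_le_two (by rw [Finset.card_univ]; omega))
  simp only [Finset.mem_insert, Finset.mem_singleton, not_or] at ha
  obtain ⟨ha1, haρ⟩ := ha
  obtain ⟨ψ, hψ, hψa⟩ := exists_even_char_fn hexp ha1 haρ
  obtain ⟨T, hT, hnb, hpair, -⟩ :=
    exists_nearBent_stabilizer_eq_pair hexp (conjGal_ne_one_fn φ₀) hcard hψ hψa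
  obtain ⟨Φ, hΦ⟩ := exists_cmType_of_isCMTypeWith (apply_conjGal_eq_fn φ₀) hT
  refine ⟨Φ, ?_, ?_⟩
  · rw [hΦ]
    exact hnb
  · rw [natCard_eq_fn hexp φ₀ Φ, hΦ, hpair, Finset.card_pair (Ne.symm ha1)]

end Imprimitive

/-! ## §3 The primitive case `|Stab(Φ)| = 1`: simple abelian varieties with exceptional Hodge classes -/

section Primitive

/-- **`|Stab(Φ)| = 1` ⟹ THE REFLEX BOUND IS STRICT**: `2·|Stab(Φ)|·(Rank(Φ) − 1) = [K:ℚ]/2 < [K:ℚ]`.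
[cite: Shimura1998, §32.10] [cite: Kubota1965, §4 Lemma 2] -/
theorem two_mul_natCard_twistStabilizer_mul_lt (hexp : ∀ g : K ≃ₐ[ℚ] K, g ^ 2 = 1) (φ₀ : K →+* ℂ)
    (Φ : CMType K)
    (hnb : ∀ χ : AddChar (Additive (K ≃ₐ[ℚ] K)) ℂ, χ (Additive.ofMul (conjGal : K ≃ₐ[ℚ] K)) = -1 →
      ∑ s ∈ (Finset.univ.filter fun s : K ≃ₐ[ℚ] K => embOf φ₀ s ∈ Φ.1), χ (Additive.ofMul s) = 0 ∨
        (∑ s ∈ (Finset.univ.filter fun s : K ≃ₐ[ℚ] K => embOf φ₀ s ∈ Φ.1), χ (Additive.ofMul s)) ^ 2 =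
          2 * ((Finset.univ.filter fun s : K ≃ₐ[ℚ] K => embOf φ₀ s ∈ Φ.1).card : ℂ))
    (h1 : Nat.card (twistStabilizer Φ) = 1) :
    2 * Nat.card (twistStabilizer Φ) * (cmTypeRank Φ - 1) < finrank ℚ K := by
  have h4 := four_mul_cmTypeRank_sub_one_eq hexp φ₀ Φ hnb
  have hpos : 0 < finrank ℚ K := finrank_pos
  rw [h1]
  omega

/-- **`|Stab(Φ)| = 1` ⟹ `[K:ℚ] ≥ 64`**: primitive near-bent types need five Boolean variables (orders `4` and `16` have
none, tree `sixtyFour_le_card_of_card_stabilizer_eq_one`). [cite: Kubota1965, §2 and §4 Lemma 2] [cite: Carlet2020, §6.2.4] -/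
theorem sixtyFour_le_finrank_of_natCard_twistStabilizer_eq_one (hexp : ∀ g : K ≃ₐ[ℚ] K, g ^ 2 = 1) (φ₀ : K →+* ℂ)
    (Φ : CMType K)
    (hnb : ∀ χ : AddChar (Additive (K ≃ₐ[ℚ] K)) ℂ, χ (Additive.ofMul (conjGal : K ≃ₐ[ℚ] K)) = -1 →
      ∑ s ∈ (Finset.univ.filter fun s : K ≃ₐ[ℚ] K => embOf φ₀ s ∈ Φ.1), χ (Additive.ofMul s) = 0 ∨
        (∑ s ∈ (Finset.univ.filter fun s : K ≃ₐ[ℚ] K => embOf φ₀ s ∈ Φ.1), χ (Additive.ofMul s)) ^ 2 =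
          2 * ((Finset.univ.filter fun s : K ≃ₐ[ℚ] K => embOf φ₀ s ∈ Φ.1).card : ℂ))
    (h1 : Nat.card (twistStabilizer Φ) = 1) : 64 ≤ finrank ℚ K := by
  haveI := Multiquadratic.isAbelianGalois_of_forall_sq_eq_one hexp
  rw [← card_gal_eq_finrank φ₀]
  rw [natCard_eq_fn hexp φ₀ Φ] at h1
  exact sixtyFour_le_card_of_card_stabilizer_eq_one hexp (isCMTypeWith_T_fn hexp φ₀ Φ) hnb h1

/-- **THE PRIMITIVE NEAR-BENT TYPES: SIMPLE ABELIAN VARIETIES WITH EXCEPTIONAL HODGE CLASSES.**  If `Φ` is near-bent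
with `|Stab(Φ)| = 1`, then every abelian variety `A` of type `(K; Φ)` is SIMPLE (primitive type, tree
`isSimple_iff_primitive`) of dimension `[K:ℚ]/2 ≥ 32`, and carries a rational `(m,m)`-class outside `Dᵐ(A) ⊗ ℂ` for
some `m` (the reflex bound is strict; Kubota–Pohlmann–White).  Whether these classes are algebraic is not decided here.
[cite: Pohlmann1968, Thm. 1] [cite: White1993SporadicCycles, §4 Theorem 3] [cite: Gordon1999HodgeAVSurvey, Thm. 6.4 and §9.2]
[cite: Shimura1998, §8.2 Prop. 26] -/
theorem isSimple_and_exists_exceptional_of_natCard_twistStabilizer_eq_one (hexp : ∀ g : K ≃ₐ[ℚ] K, g ^ 2 = 1)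
    (φ₀ : K →+* ℂ) (Φ : CMType K)
    (hnb : ∀ χ : AddChar (Additive (K ≃ₐ[ℚ] K)) ℂ, χ (Additive.ofMul (conjGal : K ≃ₐ[ℚ] K)) = -1 →
      ∑ s ∈ (Finset.univ.filter fun s : K ≃ₐ[ℚ] K => embOf φ₀ s ∈ Φ.1), χ (Additive.ofMul s) = 0 ∨
        (∑ s ∈ (Finset.univ.filter fun s : K ≃ₐ[ℚ] K => embOf φ₀ s ∈ Φ.1), χ (Additive.ofMul s)) ^ 2 =
          2 * ((Finset.univ.filter fun s : K ≃ₐ[ℚ] K => embOf φ₀ s ∈ Φ.1).card : ℂ))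
    (h1 : Nat.card (twistStabilizer Φ) = 1) (hA : IsCMTypeRealisation Φ A ι θ) :
    A.IsSimple ∧ 64 ≤ finrank ℚ K ∧
      ∃ m : ℕ, ∃ c : complexBetti A.X (2 * m), IsRationalClass c ∧
        IsOfHodgeType (finrank ℚ K / 2) A.X (2 * m) m m c ∧ c ∉ divisorClassesSpan A.X (finrank ℚ K / 2) m := by
  haveI := Multiquadratic.isAbelianGalois_of_forall_sq_eq_one hexp
  refine ⟨?_, sixtyFour_le_finrank_of_natCard_twistStabilizer_eq_one hexp φ₀ Φ hnb h1, ?_⟩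
  · exact (isSimple_iff_primitive hA).2
      ((pattern_primitive_iff_twistStabilizer_eq_bot Φ).2 (Subgroup.card_eq_one.1 h1))
  · exact exists_exceptional_of_two_mul_natCard_twistStabilizer_mul_lt Φ
      (two_mul_natCard_twistStabilizer_mul_lt hexp φ₀ Φ hnb h1) hA

/-- **THE DICHOTOMY FOR NEAR-BENT CM TYPES.**  For a near-bent `Φ` and any abelian variety `A` of type `(K; Φ)`:
EITHER `|Stab(Φ)| = 2`, `A` is not simple and the Hodge conjecture holds for every power `Aⁿ`, OR `|Stab(Φ)| = 1`, `A` is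
simple and carries an exceptional Hodge class. [cite: Gordon1999HodgeAVSurvey, Thm. 6.4, §9.2–9.3]
[cite: Shimura1998, §32.10] [cite: Kubota1965, §4 Lemma 2] -/
theorem hodgeConjectureFor_pow_or_exists_exceptional (hexp : ∀ g : K ≃ₐ[ℚ] K, g ^ 2 = 1) (φ₀ : K →+* ℂ)
    (Φ : CMType K)
    (hnb : ∀ χ : AddChar (Additive (K ≃ₐ[ℚ] K)) ℂ, χ (Additive.ofMul (conjGal : K ≃ₐ[ℚ] K)) = -1 →
      ∑ s ∈ (Finset.univ.filter fun s : K ≃ₐ[ℚ] K => embOf φ₀ s ∈ Φ.1), χ (Additive.ofMul s) = 0 ∨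
        (∑ s ∈ (Finset.univ.filter fun s : K ≃ₐ[ℚ] K => embOf φ₀ s ∈ Φ.1), χ (Additive.ofMul s)) ^ 2 =
          2 * ((Finset.univ.filter fun s : K ≃ₐ[ℚ] K => embOf φ₀ s ∈ Φ.1).card : ℂ))
    (hA : IsCMTypeRealisation Φ A ι θ) :
    (Nat.card (twistStabilizer Φ) = 2 ∧ ¬ A.IsSimple ∧
        ∀ n : ℕ, HodgeConjectureFor (⨁ fun _ : Fin n => A).dim (⨁ fun _ : Fin n => A).X) ∨
      (Nat.card (twistStabilizer Φ) = 1 ∧ A.IsSimple ∧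
        ∃ m : ℕ, ∃ c : complexBetti A.X (2 * m), IsRationalClass c ∧
          IsOfHodgeType (finrank ℚ K / 2) A.X (2 * m) m m c ∧ c ∉ divisorClassesSpan A.X (finrank ℚ K / 2) m) := by
  rcases natCard_twistStabilizer_eq_one_or_two hexp φ₀ Φ hnb with h1 | h2
  · right
    obtain ⟨hS, -, hexc⟩ := isSimple_and_exists_exceptional_of_natCard_twistStabilizer_eq_one hexp φ₀ Φ hnb h1 hA
    exact ⟨h1, hS, hexc⟩
  · left
    exact ⟨h2, not_isSimple_of_natCard_twistStabilizer_eq_two Φ h2 hA,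
      hodgeConjectureFor_pow_of_natCard_twistStabilizer_eq_two hexp φ₀ Φ hnb h2 hA⟩

end Primitive

/-! ## §4 Degrees `16` and `64` -/

section Degrees

/-- **DEGREE `16`: NEAR-BENT ⟺ `Rank(Φ) = 5`.** [cite: Kubota1965, §4 Lemma 2] [cite: Carlet2020, §6.2.4] -/
theorem nearBent_iff_cmTypeRank_eq_five_of_finrank_eq_sixteen (hexp : ∀ g : K ≃ₐ[ℚ] K, g ^ 2 = 1) (φ₀ : K →+* ℂ)
    (Φ : CMType K) (hK : finrank ℚ K = 16) :
    (∀ χ : AddChar (Additive (K ≃ₐ[ℚ] K)) ℂ, χ (Additive.ofMul (conjGal : K ≃ₐ[ℚ] K)) = -1 →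
      ∑ s ∈ (Finset.univ.filter fun s : K ≃ₐ[ℚ] K => embOf φ₀ s ∈ Φ.1), χ (Additive.ofMul s) = 0 ∨
        (∑ s ∈ (Finset.univ.filter fun s : K ≃ₐ[ℚ] K => embOf φ₀ s ∈ Φ.1), χ (Additive.ofMul s)) ^ 2 =
          2 * ((Finset.univ.filter fun s : K ≃ₐ[ℚ] K => embOf φ₀ s ∈ Φ.1).card : ℂ)) ↔
      cmTypeRank Φ = 5 := by
  haveI := Multiquadratic.isAbelianGalois_of_forall_sq_eq_one hexp
  have h16 : Fintype.card (K ≃ₐ[ℚ] K) = 16 := by rw [card_gal_eq_finrank φ₀, hK]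
  rw [cmTypeRank_eq_typeRank_galType Φ φ₀]
  exact nearBent_iff_typeRank_eq_five_of_card_eq_sixteen hexp (isCMTypeWith_T_fn hexp φ₀ Φ) h16

/-- **DEGREE `16`: EXACTLY `112` NEAR-BENT CM TYPES** (= the rank-`5` types, tree `ncard_cmTypeRank_eq_five_of_finrank_eq_sixteen`).
[cite: Kubota1965, §4 Lemma 2] [cite: Dodson1984, §3.1.1] -/
theorem ncard_nearBent_of_finrank_eq_sixteen (hexp : ∀ g : K ≃ₐ[ℚ] K, g ^ 2 = 1) (φ₀ : K →+* ℂ)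
    (hK : finrank ℚ K = 16) :
    {Φ : CMType K |
      ∀ χ : AddChar (Additive (K ≃ₐ[ℚ] K)) ℂ, χ (Additive.ofMul (conjGal : K ≃ₐ[ℚ] K)) = -1 →
        ∑ s ∈ (Finset.univ.filter fun s : K ≃ₐ[ℚ] K => embOf φ₀ s ∈ Φ.1), χ (Additive.ofMul s) = 0 ∨
          (∑ s ∈ (Finset.univ.filter fun s : K ≃ₐ[ℚ] K => embOf φ₀ s ∈ Φ.1), χ (Additive.ofMul s)) ^ 2 =
            2 * ((Finset.univ.filter fun s : K ≃ₐ[ℚ] K => embOf φ₀ s ∈ Φ.1).card : ℂ)}.ncard = 112 := by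
  rw [← ncard_cmTypeRank_eq_five_of_finrank_eq_sixteen hexp φ₀ hK]
  congr 1
  ext Φ
  simp only [Set.mem_setOf_eq]
  exact nearBent_iff_cmTypeRank_eq_five_of_finrank_eq_sixteen hexp φ₀ Φ hK

/-- **DEGREE `16`: EVERY NEAR-BENT (= RANK-`5`) TYPE HAS `|Stab(Φ)| = 2`**, so all powers of all its abelian varieties
satisfy the Hodge conjecture (the tree's rank-`5` theorem `hodgeConjectureFor_pow_of_cmTypeRank_eq_five` recovered
through the near-bent dichotomy). [cite: Kubota1965, §4 Lemma 2] [cite: Gordon1999HodgeAVSurvey, Thm. 6.4 and §9.3] -/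
theorem natCard_twistStabilizer_eq_two_of_finrank_eq_sixteen (hexp : ∀ g : K ≃ₐ[ℚ] K, g ^ 2 = 1) (φ₀ : K →+* ℂ)
    (Φ : CMType K) (hK : finrank ℚ K = 16)
    (hnb : ∀ χ : AddChar (Additive (K ≃ₐ[ℚ] K)) ℂ, χ (Additive.ofMul (conjGal : K ≃ₐ[ℚ] K)) = -1 →
      ∑ s ∈ (Finset.univ.filter fun s : K ≃ₐ[ℚ] K => embOf φ₀ s ∈ Φ.1), χ (Additive.ofMul s) = 0 ∨
        (∑ s ∈ (Finset.univ.filter fun s : K ≃ₐ[ℚ] K => embOf φ₀ s ∈ Φ.1), χ (Additive.ofMul s)) ^ 2 =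
          2 * ((Finset.univ.filter fun s : K ≃ₐ[ℚ] K => embOf φ₀ s ∈ Φ.1).card : ℂ)) :
    Nat.card (twistStabilizer Φ) = 2 := by
  haveI := Multiquadratic.isAbelianGalois_of_forall_sq_eq_one hexp
  have h16 : Fintype.card (K ≃ₐ[ℚ] K) = 16 := by rw [card_gal_eq_finrank φ₀, hK]
  rw [natCard_eq_fn hexp φ₀ Φ]
  exact card_stabilizer_eq_two_of_card_eq_sixteen hexp (isCMTypeWith_T_fn hexp φ₀ Φ) h16 hnb

/-- **DEGREE `64`: A NEAR-BENT TYPE HAS `Rank(Φ) = 17`** (of a possible `33`), and near-bent types exist there (with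
`|Stab(Φ)| = 2`: Hodge conjecture for all powers; a primitive one would give simple `32`-folds with exceptional Hodge
classes). [cite: Kubota1965, §4 Lemma 2] [cite: Carlet2020, §6.2.4] -/
theorem cmTypeRank_eq_seventeen_of_finrank_eq_sixtyFour (hexp : ∀ g : K ≃ₐ[ℚ] K, g ^ 2 = 1) (φ₀ : K →+* ℂ)
    (Φ : CMType K) (hK : finrank ℚ K = 64)
    (hnb : ∀ χ : AddChar (Additive (K ≃ₐ[ℚ] K)) ℂ, χ (Additive.ofMul (conjGal : K ≃ₐ[ℚ] K)) = -1 →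
      ∑ s ∈ (Finset.univ.filter fun s : K ≃ₐ[ℚ] K => embOf φ₀ s ∈ Φ.1), χ (Additive.ofMul s) = 0 ∨
        (∑ s ∈ (Finset.univ.filter fun s : K ≃ₐ[ℚ] K => embOf φ₀ s ∈ Φ.1), χ (Additive.ofMul s)) ^ 2 =
          2 * ((Finset.univ.filter fun s : K ≃ₐ[ℚ] K => embOf φ₀ s ∈ Φ.1).card : ℂ)) :
    cmTypeRank Φ = 17 := by
  have h4 := four_mul_cmTypeRank_sub_one_eq hexp φ₀ Φ hnb
  omega

/-- **DEGREE `64`: near-bent CM types with `|Stab(Φ)| = 2` exist**; every power of every abelian variety of such a type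
(`32`-dimensional, not simple, `Rank = 17`) satisfies the Hodge conjecture. [cite: Gordon1999HodgeAVSurvey, Thm. 6.4 and §9.3]
[cite: Carlet2020, §3.1 p. 81] [cite: Kubota1965, §4 Lemma 2] -/
theorem exists_nearBent_of_finrank_eq_sixtyFour (hexp : ∀ g : K ≃ₐ[ℚ] K, g ^ 2 = 1) (φ₀ : K →+* ℂ)
    (hK : finrank ℚ K = 64) :
    ∃ Φ : CMType K, cmTypeRank Φ = 17 ∧ Nat.card (twistStabilizer Φ) = 2 ∧
      ∀ (A : AbelianVariety ℂ) (ι : 𝓞 K →+* End A) (θ : K →+* Module.End ℂ (complexBetti A.X 1)),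
        IsCMTypeRealisation Φ A ι θ →
          ∀ n : ℕ, HodgeConjectureFor (⨁ fun _ : Fin n => A).dim (⨁ fun _ : Fin n => A).X := by
  obtain ⟨Φ, hnb, h2⟩ := exists_nearBent_natCard_twistStabilizer_eq_two hexp φ₀ (k := 2) (by rw [hK]; norm_num)
  exact ⟨Φ, cmTypeRank_eq_seventeen_of_finrank_eq_sixtyFour hexp φ₀ Φ hK hnb, h2,
    fun A ι θ hA n => hodgeConjectureFor_pow_of_natCard_twistStabilizer_eq_two hexp φ₀ Φ hnb h2 hA n⟩

end Degrees

end MultiquadraticNearBent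

end Literature.AlgebraicGeometry.Pohlmann1968
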